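import Summits.QuantumFields.YangMills.Theorems.BalabanUVNodesN27AtAllPinsOfRecord13CoPHVCutFSC

/-!
# BalabanUVNodes ∕ N27 = binder B5 AT THE RECORD — storey MP: storey AP (`…N27AtAllPinsOfRecord13CoPHVCutFSC`, dag-n27-c g13 p605269) WITH THE ALL-PINS READING MINTED —
# the four v5 reading pins DISCHARGED, every reading-dependent binder re-keyed at the SPELLED BUNDLE OF LETTERS, no rate reading `𝔯` anywhere
# (cell `pub-ymgap`, HUMAN RULING D-0062 Track A; WIDTH SEAT `pub-ymgap-dag-n27-w1` gen 3 on NODE n27 (B5 composite); dag-n27-c g13's word «YOURS — GO» pub-ymgap INBOX 2026-08-28T06:38Z;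
# K3⁷ `SpineGivenEndpointR13SepCoPH` = stmt-QuantumFields-20544, `--kind proof --supports 20544 --as helper`; COUNT-NEUTRAL; THEOREMS ONLY, 0 `def`, 0 `sorry`; `N`-generic, `K₀`-generic,
# regime-generic, NO Theses import; item faces in leaf `…N27SpineGivenEndpointR13SepCoPHMintedReadingV`)

WHY.  K3⁷ v5 (941dddb108cbaacf) keys stub 1 on `∃ 𝔯 …, GuardedReadingN16 𝔯 ksel ℓ ℓ₃ g B ∧ …`; this seat's `…K3V5Stub1LetterForm` (p608315) MINTED the reading carrying all four pins for
every letter choice — `⟨fun F θ hP g₀ os ↦ ⟨objectsOfRecord₁₃ F N θ (ℓ F θ), fun _ ↦ loose N16 layer (ℓ₃, B), fun _ ↦ fullGSizedObjects 3 F.hL b a_S …⟩, ne1OfRecord l₀ Λ⟩`, four `rfl` — and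
showed its bundle of record IS the spelled bundle of letters (`rrOfRecord_eq_of_pins`, `stub1Text_iff_letterForm`).  Storey AP keeps the pins `hpin1 hpin2 hpinL hpin` as HYPOTHESES on a FREE
`𝔯`; HERE they are discharged by that reading (inlined — no `def`), so B5 at the regime record class reads NO rate reading at all:

* §1 ★★★ `spine_rec13CCoPHOn_of_mintedV5Pins_fsc_at_crOfRecord₁₃VAt_cut_of_letters` — any regime `Rg`, `hsel` per tuple: AP §2 with `𝔯 :=` the minted reading of the letters
  `(l₀, Λ, b, a_S, ν, μ, α, β′, c₃₅, p, ℓ, ℓ₃, B)` (`0 < l₀`, `0 ≤ Λ`, `0 < b`, `0 < a_S`); the FSC-keyed N19′ face `h19` reads v5's `PHolderD4 β` SPELLED AT THE BUNDLE OF LETTERS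
  `⟨ne1OfRecord l₀ Λ …, ne2OfRecord₁₁ (fullGSizedObjects …), ne3OfRecord₁₁ F (loose layer), u3OfRecord₁₃ θ (objectsOfRecord₁₃ F N θ (ℓ F θ)) (ksel …)⟩`; every other binder VERBATIM AP's.
* §2 ★★★ `spine_rec13CCoPHOn_live_of_mintedV5Pins_fsc_at_crOfRecord₁₃VAt_cut_of_letters` — the live-line edition (`Rg := G ∧ LiveSel` spelled), AP §3 likewise.
So B5 at the regime record class costs EXACTLY: `h16` (ONE `N16HolderAt … β` per family carrying a regime tuple, at the loose-data object) · def-W1's four kernel letters · the U3 rows ·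
`hsel hζm` · keyed N20 ∕ N21 witnesses · the FSC-keyed N19′ face at the bundle of letters — and NOTHING about a reading.  Proof = ONE application of AP per theorem (pins by `rfl`).

HONEST FRAMING.  COMPOSITE-node bookkeeping BY NAME; a REDUCTION, not a discharge; every displayed antecedent is a HYPOTHESIS inhabited for no family today (K0⁷ `Record13SepCoPHInhabited`
OPEN) or a decided MODEL inside the minted reading (n14-w1's datum-read tower `ne1OfRecord l₀ Λ`; dag-n15-a's sized genuine family — MODEL LEVEL w.r.t. the background field, v5 (A3-iii));
N16 at the loose-data object = THE END's content (hypothesis; `B` a free letter); def-W1's kernel letters are finite-volume statements of Bałaban-type SHAPE NOT PRINTED as such for d = 4 ((1.21)'s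
existence NOT proved; (5.10) of the limiting kernels = print's claim [Balaban1987RG1] p.293); NE7-cluster ∕ K5 ∕ the N19′ edge 0∕1 today; `jc`, `sh`, `ksel`, the letters, `β` FREE PARAMETERS; nothing
of Bałaban's asserted or instantiated; NOT `stub_rates13H` ∕ `stub_expansion13H`; N14–N22 ∕ N27 NOT discharged; K3⁷ OPEN, NOT claimed; skeleton v5 UNTOUCHED (plan's); counts UNMOVED (typed 28∕28 ·
discharged 5∕27, A 5∕28); one finite four-torus programme at fixed `ε` — NOT ℝ⁴, NOT infinite volume, NOT OS, NOT a mass gap, NOT Clay.  No decl below carries a cite tag.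
-/

set_option autoImplicit false

namespace Summit.QuantumFields.YangMills.Theorems.BalabanUVNodesN27SpineRecord

open scoped BigOperators Matrix.Norms.L2Operator
open Literature.MathematicalPhysics.QuantumFieldTheory.Balaban1983to89
open Literature.MathematicalPhysics.QuantumFieldTheory.Balaban1983to89.T4Continuum
open Literature.MathematicalPhysics.QuantumFieldTheory.Balaban1983to89.Node00
open Literature.MathematicalPhysics.QuantumFieldTheory.Balaban1983to89.B12Sec2to5 (betaPrime510)
open Literature.MathematicalPhysics.QuantumFieldTheory.Balaban1983to89.Node00.U3OfKernels (objectsOfRecord₁₃ KernelDecayOfRecord₁₃)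
open Literature.MathematicalPhysics.QuantumFieldTheory.Balaban1983to89.Node00.U3KernelLetters (PolLimitsExistOfRecord₁₃ WindowedNE9OfRecord₁₃ WindowedDecayOfRecord₁₃
  WindowedStepRateOfRecord₁₃)
open T4WeightBudget (RelWeightBound)
open T4IndicatorShell (ShellWeightBound)
open T4ContinuumYM4Torus (ForSmallCouplings)
open Summit.QuantumFields.BalabanUV.T4Continuum.Spine
open YMDAG.UVSplit
open Summit.QuantumFields.BalabanUV.T4Continuum.MinimalActionRate (sfClass)
open Summit.QuantumFields.YangMills.BalabanUVNodes.N19TargetClassWeightsE1Keyed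
open Summit.QuantumFields.YangMills.BalabanUVNodes.N16HolderDefs (N16HolderAt)
open Summit.QuantumFields.YangMills.BalabanUVNodes.SpineRatesHolder (RatesHolderAt)
open YMDAG.N14.TopBorn (Ne1PinnedOfRecord ne1OfRecord)
open Summit.QuantumFields.YangMills.BalabanUVNodes.N15.GenuineRecord (fullGSizedObjects)
open Summit.QuantumFields.YangMills.BalabanUVNodes.N15.AtKeyedHome (neZero_blockFactor)
open Summit.QuantumFields.YangMills.BalabanUVNodes.N16PinnedLayer13CoPH (N16PinnedLoose)

variable {N : ℕ} [NeZero N] (K₀ : ℕ)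
  (jc : (F : T4Family) → (θ : Stage13HParams F N) → θ.Provisos₁₃CoPH F N → (ℕ → ℝ) → List (ULoop F) → ℕ → ℕ)
  (sh : ShellSplit₁₃CoPH N K₀) (β : ℝ)
  -- the LETTERS of the minted reading (N14 tower `l₀ Λ`; the sized genuine N15 family `b a_S ν μ α β′ c₃₅ p`; node U3's letter block `ℓ`; N16's letters `ℓ₃` and radius letter `B`)
  (l₀ Λ b aS : ℝ) (ν μ α β' : Fin 4) (c35 p : ℝ)
  (ksel : (F : T4Family) → (θ : Stage13HParams F N) → θ.Provisos₁₃CoPH F N → (ℕ → ℝ) → List (ULoop F) → ℕ)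
  (ℓ : (F : T4Family) → Stage13HParams F N → U3Letters₁₁) (s : (F : T4Family) → Stage13HParams F N → ℕ)
  (ℓ₃ : T4Family → NE3Letters₁₁) (B : T4Family → ℝ)

/-! ## §1 Any regime `Rg` (`hsel` per tuple): AP §2 with the reading MINTED -/

/-- ★★★ **N27 = B5 AT THE REGIME RECORD CLASS FROM THE MINTED ALL-PINS READING, K5 AT THE PER-TUPLE-CUT SPINE READING OF RECORD** — storey AP §2
`spine_rec13CCoPHOn_of_v5pins_fsc_at_crOfRecord₁₃VAt_cut_of_letters` with its four pin hypotheses `hpin1 hpin2 hpinL hpin` DISCHARGED by the reading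
`⟨fun F θ hP g₀ os ↦ ⟨objectsOfRecord₁₃ F N θ (ℓ F θ), fun _ ↦ loose N16 layer (ℓ₃, B), fun _ ↦ fullGSizedObjects 3 F.hL b a_S ν μ α β′ c₃₅ p⟩, ne1OfRecord l₀ Λ⟩` (four `rfl`; `0 < l₀`, `0 ≤ Λ`, `0 < b`,
`0 < a_S`).  Displayed, VERBATIM AP's: `h16` · U3 rows `hs hκ hcr hρ` · kernel letters `hL h9 hW hS` · `hsel hζm` · keyed N20 ∕ N21 witnesses `h20 h21` · the FSC-keyed N19′ face `h19`, now reading v5's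
`PHolderD4 β` SPELLED AT THE BUNDLE OF LETTERS.  No rate reading in the statement.  NOT a discharge; no stub of v5 closed. [bookkeeping] -/
theorem spine_rec13CCoPHOn_of_mintedV5Pins_fsc_at_crOfRecord₁₃VAt_cut_of_letters (Rg : (F : T4Family) → Stage13HParams F N → Prop)
    (hl₀ : 0 < l₀) (hΛ : 0 ≤ Λ) (hb : 0 < b) (haS : 0 < aS)
    (h16 : ∀ (F : T4Family), (∃ θ : Stage13HParams F N, θ.Provisos₁₃CoPH F N ∧ Rg F θ ∧ θ.Admissible F N) →
      N16HolderAt (ne3OfRecord₁₁ F { ne3ConstLayerOfRecord₁₁ F N (ℓ₃ F) with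
        dom := {V | V ∈ ne3DomOfRecord₁₁ F N 0 0 ∧ V ∈ sfClass 4 F.L (ne3NperOfRecord₁₁ F 0 0) ((ℓ₃ F).ε / B F) 0} }) β)
    (hs : ∀ (F : T4Family) (θ : Stage13HParams F N), θ.Provisos₁₃CoPH F N → Rg F θ → θ.Admissible F N → (ℓ F θ).Signs)
    (hκ : ∀ (F : T4Family) (θ : Stage13HParams F N), θ.Provisos₁₃CoPH F N → Rg F θ → θ.Admissible F N → 0 < (ℓ F θ).κ)
    (hcr : ∀ (F : T4Family) (θ : Stage13HParams F N), θ.Provisos₁₃CoPH F N → Rg F θ → θ.Admissible F N →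
      betaPrime510 4 1 (ℓ F θ).κ ≤ (ℓ F θ).cr)
    (hρ : ∀ (F : T4Family) (θ : Stage13HParams F N), θ.Provisos₁₃CoPH F N → Rg F θ → θ.Admissible F N →
      0 ≤ (ℓ F θ).ρ ∧ (ℓ F θ).ρ < 1)
    (hL : ∀ (F : T4Family) (θ : Stage13HParams F N), θ.Provisos₁₃CoPH F N → Rg F θ → θ.Admissible F N →
      PolLimitsExistOfRecord₁₃ F N θ.toStage13Params)
    (h9 : ∀ (F : T4Family) (θ : Stage13HParams F N), θ.Provisos₁₃CoPH F N → Rg F θ → θ.Admissible F N →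
      WindowedNE9OfRecord₁₃ F N θ.toStage13Params (ℓ F θ).κ (ℓ F θ).moduli)
    (hW : ∀ (F : T4Family) (θ : Stage13HParams F N), θ.Provisos₁₃CoPH F N → Rg F θ → θ.Admissible F N →
      WindowedDecayOfRecord₁₃ F N θ.toStage13Params 0 1 (ℓ F θ).κ)
    (hS : ∀ (F : T4Family) (θ : Stage13HParams F N), θ.Provisos₁₃CoPH F N → Rg F θ → θ.Admissible F N →
      WindowedStepRateOfRecord₁₃ F N θ.toStage13Params (s F θ) (ℓ F θ).κ (ℓ F θ).θ₅ ((ℓ F θ).C₅ * (ℓ F θ).θ₅))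
    (hsel : ∀ (F : T4Family) (θ : Stage13HParams F N), θ.Provisos₁₃CoPH F N → Rg F θ → θ.Admissible F N →
      ∃ E : B12.RunParams → ℝ, θ.ppSel = ppSelLiveOfRecord F N θ.ν θ.τ9 E (wOfRecord₉ F N θ.toStage9Params))
    (hζm : ∀ (F : T4Family) (θ : Stage13HParams F N), θ.Provisos₁₃CoPH F N → Rg F θ → θ.Admissible F N → ZetaMeasurable F N θ.ζ)
    (h20 : ∀ (F : T4Family) (θ : Stage13HParams F N) (hP : θ.Provisos₁₃CoPH F N), Rg F θ → θ.Admissible F N →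
      ∀ (g₀ : ℕ → ℝ) (os : List (ULoop F)),
        ∃ W : ℕ → ℝ, RelWeightBound 1 (classSet₁₃ θ K₀ g₀) (weightA₁₃ θ hP K₀ g₀ os) (weightB₁₃ θ hP K₀ g₀ os) (badClass₁₃ θ K₀ g₀ (jc F θ hP g₀ os)) W)
    (h21 : ∀ (F : T4Family) (θ : Stage13HParams F N) (hP : θ.Provisos₁₃CoPH F N), Rg F θ → θ.Admissible F N →
      ∀ (g₀ : ℕ → ℝ) (os : List (ULoop F)),
        ∃ Wsh : ℕ → ℝ, ShellWeightBound 1 (classSet₁₃ θ K₀ g₀) (weightA₁₃ θ hP K₀ g₀ os) (weightB₁₃ θ hP K₀ g₀ os) (sh F θ hP g₀ os).1 (sh F θ hP g₀ os).2 Wsh)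
    (h19 : ∀ (F : T4Family) (θ : Stage13HParams F N) (hP : θ.Provisos₁₃CoPH F N), Rg F θ → θ.Admissible F N →
      B16.EndStatementBPrinted (datumOfRecord₁₃CoPH F N θ hP).C → DagBinding.EndpointExistence (datumOfRecord₁₃CoPH F N θ hP).C.toB12 →
        ForSmallCouplings (datumOfRecord₁₃CoPH F N θ hP) fun g₀ => ∀ os : List (ULoop F),
          (RatesHolderAt (datumOfRecord₁₃CoPH F N θ hP)
            ⟨ne1OfRecord l₀ Λ F θ hP g₀ os, ne2OfRecord₁₁ (haveI := neZero_blockFactor F; fullGSizedObjects 3 F.hL b aS ν μ α β' c35 p),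
              ne3OfRecord₁₁ F { ne3ConstLayerOfRecord₁₁ F N (ℓ₃ F) with
                dom := {V | V ∈ ne3DomOfRecord₁₁ F N 0 0 ∧ V ∈ sfClass 4 F.L (ne3NperOfRecord₁₁ F 0 0) ((ℓ₃ F).ε / B F) 0} },
              u3OfRecord₁₃ θ.toStage13Params (objectsOfRecord₁₃ F N θ.toStage13Params (ℓ F θ)) (ksel F θ hP g₀ os)⟩ β ∧
              ReadOutAt (datumOfRecord₁₃CoPH F N θ hP) (u3OfRecord₁₃ θ.toStage13Params (objectsOfRecord₁₃ F N θ.toStage13Params (ℓ F θ)) (ksel F θ hP g₀ os)) ∧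
              (0 ≤ (u3OfRecord₁₃ θ.toStage13Params (objectsOfRecord₁₃ F N θ.toStage13Params (ℓ F θ)) (ksel F θ hP g₀ os)).ρ ∧
                (u3OfRecord₁₃ θ.toStage13Params (objectsOfRecord₁₃ F N θ.toStage13Params (ℓ F θ)) (ksel F θ hP g₀ os)).ρ < 1)) →
            letI : DecidableEq (Σ K, SiteSeqKey F (K₀ + K)) := Classical.decEq _
            ∃ δ : ℕ → ℝ, NE7.Core 1 (F.side ^ 4) (classSet₁₃ θ K₀ g₀) (badClass₁₃ θ K₀ g₀ (jc F θ hP g₀ os))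
              (fun K t x => weightA₁₃ θ hP K₀ g₀ os K t x - (sh F θ hP g₀ os).1 K t x)
              (fun K t x => weightB₁₃ θ hP K₀ g₀ os K t x - (sh F θ hP g₀ os).2 K t x) δ ∧ Summable δ) :
    Spine (N := N) fun F D w => Node00.IsRecordOfRecord₁₃CCoPHOn F N Rg D w := by
  let lit : (F : T4Family) → (θ : Stage13HParams F N) → θ.Provisos₁₃CoPH F N → (ℕ → ℝ) → List (ULoop F) → RateObjects₁₁ N :=
    fun F θ _ _ _ =>
      ⟨objectsOfRecord₁₃ F N θ.toStage13Params (ℓ F θ),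
        fun _ => { ne3ConstLayerOfRecord₁₁ F N (ℓ₃ F) with
          dom := {V | V ∈ ne3DomOfRecord₁₁ F N 0 0 ∧ V ∈ sfClass 4 F.L (ne3NperOfRecord₁₁ F 0 0) ((ℓ₃ F).ε / B F) 0} },
        fun _ => haveI := neZero_blockFactor F; fullGSizedObjects 3 F.hL b aS ν μ α β' c35 p⟩
  exact spine_rec13CCoPHOn_of_v5pins_fsc_at_crOfRecord₁₃VAt_cut_of_letters (𝔯 := ⟨lit, ne1OfRecord l₀ Λ⟩) (K₀ := K₀) (jc := jc) (sh := sh) (β := β)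
    (ksel := ksel) (ℓ := ℓ) (s := s) (ℓ₃ := ℓ₃) (B := B) (Rg := Rg) (hpin1 := ⟨l₀, Λ, hl₀, hΛ, fun _ _ _ _ _ => rfl⟩)
    (hpin2 := ⟨b, aS, ν, μ, α, β', c35, p, hb, haS, fun _ _ _ _ _ _ => rfl⟩) (hpinL := fun _ _ _ _ _ _ => rfl) (hpin := fun _ _ _ _ _ => rfl)
    (h16 := h16) (hs := hs) (hκ := hκ) (hcr := hcr) (hρ := hρ) (hL := hL) (h9 := h9) (hW := hW) (hS := hS) (hsel := hsel) (hζm := hζm) (h20 := h20)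
    (h21 := h21) (h19 := h19)

/-! ## §2 On the live-selector line of a regime `G` (`Rg := G ∧ LiveSel` spelled): AP §3 with the reading MINTED -/

section Live

variable (G : (F : T4Family) → Stage13HParams F N → Prop)

/-- ★★★ **§1 ON THE LIVE LINE OF A REGIME `G`** — storey AP §3 `spine_rec13CCoPHOn_live_of_v5pins_fsc_at_crOfRecord₁₃VAt_cut_of_letters` with the reading MINTED (pins by `rfl`): at `N = 2`,
`G :=` the item's guard, `K₀ = 0` the displayed binders ARE v5's stub-1 content IN LETTER FORM (p608315 `stub1Text_iff_letterForm`: `h16` + kernel letters + U3 rows + the FSC `h19` face at the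
bundle of letters) and v5's stub-2 content AT THE SPINE PIN, composed to B5 on the live line.  Every row a HYPOTHESIS or a decided MODEL. [bookkeeping] -/
theorem spine_rec13CCoPHOn_live_of_mintedV5Pins_fsc_at_crOfRecord₁₃VAt_cut_of_letters
    (hl₀ : 0 < l₀) (hΛ : 0 ≤ Λ) (hb : 0 < b) (haS : 0 < aS)
    (h16 : ∀ (F : T4Family), (∃ θ : Stage13HParams F N, θ.Provisos₁₃CoPH F N ∧ (G F θ ∧ θ.ppSel = ppSelLiveOfRecord F N θ.ν θ.τ9 (EOfRecord₁₃ F N θ.toStage13Params) (wOfRecord₉ F N θ.toStage9Params)) ∧ θ.Admissible F N) →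
      N16HolderAt (ne3OfRecord₁₁ F { ne3ConstLayerOfRecord₁₁ F N (ℓ₃ F) with
        dom := {V | V ∈ ne3DomOfRecord₁₁ F N 0 0 ∧ V ∈ sfClass 4 F.L (ne3NperOfRecord₁₁ F 0 0) ((ℓ₃ F).ε / B F) 0} }) β)
    (hs : ∀ (F : T4Family) (θ : Stage13HParams F N), θ.Provisos₁₃CoPH F N → (G F θ ∧ θ.ppSel = ppSelLiveOfRecord F N θ.ν θ.τ9 (EOfRecord₁₃ F N θ.toStage13Params) (wOfRecord₉ F N θ.toStage9Params)) → θ.Admissible F N → (ℓ F θ).Signs)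
    (hκ : ∀ (F : T4Family) (θ : Stage13HParams F N), θ.Provisos₁₃CoPH F N → (G F θ ∧ θ.ppSel = ppSelLiveOfRecord F N θ.ν θ.τ9 (EOfRecord₁₃ F N θ.toStage13Params) (wOfRecord₉ F N θ.toStage9Params)) → θ.Admissible F N → 0 < (ℓ F θ).κ)
    (hcr : ∀ (F : T4Family) (θ : Stage13HParams F N), θ.Provisos₁₃CoPH F N → (G F θ ∧ θ.ppSel = ppSelLiveOfRecord F N θ.ν θ.τ9 (EOfRecord₁₃ F N θ.toStage13Params) (wOfRecord₉ F N θ.toStage9Params)) → θ.Admissible F N →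
      betaPrime510 4 1 (ℓ F θ).κ ≤ (ℓ F θ).cr)
    (hρ : ∀ (F : T4Family) (θ : Stage13HParams F N), θ.Provisos₁₃CoPH F N → (G F θ ∧ θ.ppSel = ppSelLiveOfRecord F N θ.ν θ.τ9 (EOfRecord₁₃ F N θ.toStage13Params) (wOfRecord₉ F N θ.toStage9Params)) → θ.Admissible F N →
      0 ≤ (ℓ F θ).ρ ∧ (ℓ F θ).ρ < 1)
    (hL : ∀ (F : T4Family) (θ : Stage13HParams F N), θ.Provisos₁₃CoPH F N → (G F θ ∧ θ.ppSel = ppSelLiveOfRecord F N θ.ν θ.τ9 (EOfRecord₁₃ F N θ.toStage13Params) (wOfRecord₉ F N θ.toStage9Params)) → θ.Admissible F N →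
      PolLimitsExistOfRecord₁₃ F N θ.toStage13Params)
    (h9 : ∀ (F : T4Family) (θ : Stage13HParams F N), θ.Provisos₁₃CoPH F N → (G F θ ∧ θ.ppSel = ppSelLiveOfRecord F N θ.ν θ.τ9 (EOfRecord₁₃ F N θ.toStage13Params) (wOfRecord₉ F N θ.toStage9Params)) → θ.Admissible F N →
      WindowedNE9OfRecord₁₃ F N θ.toStage13Params (ℓ F θ).κ (ℓ F θ).moduli)
    (hW : ∀ (F : T4Family) (θ : Stage13HParams F N), θ.Provisos₁₃CoPH F N → (G F θ ∧ θ.ppSel = ppSelLiveOfRecord F N θ.ν θ.τ9 (EOfRecord₁₃ F N θ.toStage13Params) (wOfRecord₉ F N θ.toStage9Params)) → θ.Admissible F N →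
      WindowedDecayOfRecord₁₃ F N θ.toStage13Params 0 1 (ℓ F θ).κ)
    (hS : ∀ (F : T4Family) (θ : Stage13HParams F N), θ.Provisos₁₃CoPH F N → (G F θ ∧ θ.ppSel = ppSelLiveOfRecord F N θ.ν θ.τ9 (EOfRecord₁₃ F N θ.toStage13Params) (wOfRecord₉ F N θ.toStage9Params)) → θ.Admissible F N →
      WindowedStepRateOfRecord₁₃ F N θ.toStage13Params (s F θ) (ℓ F θ).κ (ℓ F θ).θ₅ ((ℓ F θ).C₅ * (ℓ F θ).θ₅))
    (hζm : ∀ (F : T4Family) (θ : Stage13HParams F N), θ.Provisos₁₃CoPH F N → (G F θ ∧ θ.ppSel = ppSelLiveOfRecord F N θ.ν θ.τ9 (EOfRecord₁₃ F N θ.toStage13Params) (wOfRecord₉ F N θ.toStage9Params)) → θ.Admissible F N →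
      ZetaMeasurable F N θ.ζ)
    (h20 : ∀ (F : T4Family) (θ : Stage13HParams F N) (hP : θ.Provisos₁₃CoPH F N), (G F θ ∧ θ.ppSel = ppSelLiveOfRecord F N θ.ν θ.τ9 (EOfRecord₁₃ F N θ.toStage13Params) (wOfRecord₉ F N θ.toStage9Params)) → θ.Admissible F N →
      ∀ (g₀ : ℕ → ℝ) (os : List (ULoop F)),
        ∃ W : ℕ → ℝ, RelWeightBound 1 (classSet₁₃ θ K₀ g₀) (weightA₁₃ θ hP K₀ g₀ os) (weightB₁₃ θ hP K₀ g₀ os) (badClass₁₃ θ K₀ g₀ (jc F θ hP g₀ os)) W)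
    (h21 : ∀ (F : T4Family) (θ : Stage13HParams F N) (hP : θ.Provisos₁₃CoPH F N), (G F θ ∧ θ.ppSel = ppSelLiveOfRecord F N θ.ν θ.τ9 (EOfRecord₁₃ F N θ.toStage13Params) (wOfRecord₉ F N θ.toStage9Params)) → θ.Admissible F N →
      ∀ (g₀ : ℕ → ℝ) (os : List (ULoop F)),
        ∃ Wsh : ℕ → ℝ, ShellWeightBound 1 (classSet₁₃ θ K₀ g₀) (weightA₁₃ θ hP K₀ g₀ os) (weightB₁₃ θ hP K₀ g₀ os) (sh F θ hP g₀ os).1 (sh F θ hP g₀ os).2 Wsh)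
    (h19 : ∀ (F : T4Family) (θ : Stage13HParams F N) (hP : θ.Provisos₁₃CoPH F N), (G F θ ∧ θ.ppSel = ppSelLiveOfRecord F N θ.ν θ.τ9 (EOfRecord₁₃ F N θ.toStage13Params) (wOfRecord₉ F N θ.toStage9Params)) → θ.Admissible F N →
      B16.EndStatementBPrinted (datumOfRecord₁₃CoPH F N θ hP).C → DagBinding.EndpointExistence (datumOfRecord₁₃CoPH F N θ hP).C.toB12 →
        ForSmallCouplings (datumOfRecord₁₃CoPH F N θ hP) fun g₀ => ∀ os : List (ULoop F),
          (RatesHolderAt (datumOfRecord₁₃CoPH F N θ hP)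
            ⟨ne1OfRecord l₀ Λ F θ hP g₀ os, ne2OfRecord₁₁ (haveI := neZero_blockFactor F; fullGSizedObjects 3 F.hL b aS ν μ α β' c35 p),
              ne3OfRecord₁₁ F { ne3ConstLayerOfRecord₁₁ F N (ℓ₃ F) with
                dom := {V | V ∈ ne3DomOfRecord₁₁ F N 0 0 ∧ V ∈ sfClass 4 F.L (ne3NperOfRecord₁₁ F 0 0) ((ℓ₃ F).ε / B F) 0} },
              u3OfRecord₁₃ θ.toStage13Params (objectsOfRecord₁₃ F N θ.toStage13Params (ℓ F θ)) (ksel F θ hP g₀ os)⟩ β ∧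
              ReadOutAt (datumOfRecord₁₃CoPH F N θ hP) (u3OfRecord₁₃ θ.toStage13Params (objectsOfRecord₁₃ F N θ.toStage13Params (ℓ F θ)) (ksel F θ hP g₀ os)) ∧
              (0 ≤ (u3OfRecord₁₃ θ.toStage13Params (objectsOfRecord₁₃ F N θ.toStage13Params (ℓ F θ)) (ksel F θ hP g₀ os)).ρ ∧
                (u3OfRecord₁₃ θ.toStage13Params (objectsOfRecord₁₃ F N θ.toStage13Params (ℓ F θ)) (ksel F θ hP g₀ os)).ρ < 1)) →
            letI : DecidableEq (Σ K, SiteSeqKey F (K₀ + K)) := Classical.decEq _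
            ∃ δ : ℕ → ℝ, NE7.Core 1 (F.side ^ 4) (classSet₁₃ θ K₀ g₀) (badClass₁₃ θ K₀ g₀ (jc F θ hP g₀ os))
              (fun K t x => weightA₁₃ θ hP K₀ g₀ os K t x - (sh F θ hP g₀ os).1 K t x)
              (fun K t x => weightB₁₃ θ hP K₀ g₀ os K t x - (sh F θ hP g₀ os).2 K t x) δ ∧ Summable δ) :
    Spine (N := N) fun F D w => Node00.IsRecordOfRecord₁₃CCoPHOn F N
      (fun F θ => G F θ ∧ θ.ppSel = ppSelLiveOfRecord F N θ.ν θ.τ9 (EOfRecord₁₃ F N θ.toStage13Params) (wOfRecord₉ F N θ.toStage9Params)) D w := by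
  let lit : (F : T4Family) → (θ : Stage13HParams F N) → θ.Provisos₁₃CoPH F N → (ℕ → ℝ) → List (ULoop F) → RateObjects₁₁ N :=
    fun F θ _ _ _ =>
      ⟨objectsOfRecord₁₃ F N θ.toStage13Params (ℓ F θ),
        fun _ => { ne3ConstLayerOfRecord₁₁ F N (ℓ₃ F) with
          dom := {V | V ∈ ne3DomOfRecord₁₁ F N 0 0 ∧ V ∈ sfClass 4 F.L (ne3NperOfRecord₁₁ F 0 0) ((ℓ₃ F).ε / B F) 0} },
        fun _ => haveI := neZero_blockFactor F; fullGSizedObjects 3 F.hL b aS ν μ α β' c35 p⟩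
  exact spine_rec13CCoPHOn_live_of_v5pins_fsc_at_crOfRecord₁₃VAt_cut_of_letters (𝔯 := ⟨lit, ne1OfRecord l₀ Λ⟩) (K₀ := K₀) (jc := jc) (sh := sh)
    (β := β) (ksel := ksel) (ℓ := ℓ) (s := s) (ℓ₃ := ℓ₃) (B := B) (G := G) (hpin1 := ⟨l₀, Λ, hl₀, hΛ, fun _ _ _ _ _ => rfl⟩)
    (hpin2 := ⟨b, aS, ν, μ, α, β', c35, p, hb, haS, fun _ _ _ _ _ _ => rfl⟩) (hpinL := fun _ _ _ _ _ _ => rfl) (hpin := fun _ _ _ _ _ => rfl)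
    (h16 := h16) (hs := hs) (hκ := hκ) (hcr := hcr) (hρ := hρ) (hL := hL) (h9 := h9) (hW := hW) (hS := hS) (hζm := hζm) (h20 := h20) (h21 := h21)
    (h19 := h19)

end Live

end Summit.QuantumFields.YangMills.Theorems.BalabanUVNodesN27SpineRecord
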